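import Summits.Parity.BatemanHorn.Theorems.AlmostPrimeZerosSystemMomentDeficitAssemblyBlocks

/-!
# Crux `SystemMomentDeficit` (stmt-Parity-11326), line `Ideator3Sketch`: assembly, part 3 (core)

The assembly at one `x ≥ 256` with all inputs frozen (`assembly_core`): the index sets
`Px ⊇ Pz ⊇ Py` of prime powers, the indicator family `Zf (i, q)(n) = [q ∣ fᵢ(n)⁺ ≠ 0]`, the
root-class bound, the harmonic / log-mass sums, the capped-statistic sandwich, the two pair blocks
(`ablock_le`, `covU_ge` of part 2) and the decorrelated covariance bound at `x`.  Output: the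
moment deficit of the crux at `x`, bounded by an explicit constant.

Notation (docstrings only).  `Y = x + 1`, `E g = Y⁻¹ Σ_{0 ≤ n ≤ x} g(n)`, `a = A_z`, `U = A_x − A_z`,
`N = s_f − A_x`, `b = U + N`, `W`, `M` the size-orthogonal count and the log-mass at height `y`.
Everything is [folklore].
-/

namespace Summit.Parity.BatemanHorn.Cruxes.SystemMomentDeficit.Ideator3Sketch

open scoped BigOperators
open Finset Polynomial
open Literature.NumberTheory.Sieve
open Summit.Parity.BatemanHorn.Theorems.AlmostPrimeZeros.SystemMertens

/-- **The assembly at one `x` (core).**  Given the frozen index sets `Px ⊇ Pz ⊇ Py` (the prime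
powers `PP(x) ⊇ PP(⌊√x⌋) ⊇ PP(⌊x^{1/4}⌋)`), the indicator family `Zf`, the root-class bound
`E 1_{i,q} ≤ 2D/q`, the harmonic/log-mass sums, the capped-statistic sandwich
`#{q ∈ Px : q ∣ m} ≤ s(m) ≤ #{…} + 2(d + H)`, the two pair blocks and the decorrelated covariance
bound at `x`, the moment deficit at `x` is bounded by the displayed constant:
`E s − Var s = (E a − Var a) + (E b − Var b) − 2Cov(a, U) − 2Cov(a, N)` with `s = a + b`,
`b = U + N`, `Var b ≥ 0`, `E b = E U + E N ≤ 2kD(c_W + 1) + K`, and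
`Cov(a, N) = Cov(a − a_y, N) + Cov(W, N) + λCov(M, N)`, `a_y = W + λM`, `λ = 2/log y`. [folklore] -/
theorem assembly_core :
    ∀ (k : ℕ) (f : Fin k → ℤ[X]) (x y : ℕ) (Px Pz Py : Finset ℕ)
    (Zf : Fin k × ℕ → ℕ → ℝ) (D K CpS cW C2 CK : ℝ)
    (hx1 : 1 ≤ x) (hD0 : 0 ≤ D) (hK0 : 0 ≤ K) (hlogy : 1 ≤ Real.log y)
    (hPyz : Py ⊆ Pz) (hPzx : Pz ⊆ Px)
    (hZfdef : ∀ t n, Zf t n =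
      if t.2 ∣ ((f t.1).eval (n : ℤ)).toNat ∧ ((f t.1).eval (n : ℤ)).toNat ≠ 0 then 1 else 0)
    (he : ∀ t : Fin k × ℕ, t.2 ∈ Px →
      (∑ n ∈ range (x + 1), Zf t n) / ((x : ℝ) + 1) ≤ 2 * D / (t.2 : ℝ))
    (hsum1 : ∑ q ∈ Px \ Pz, (1 : ℝ) / (q : ℝ) ≤ cW + 1)
    (hsum2 : ∑ q ∈ Pz \ Py, (1 : ℝ) / (q : ℝ) ≤ cW + 1)
    (hsum3 : ∑ q ∈ Py, ArithmeticFunction.vonMangoldt q / (q : ℝ) ≤ 2 * Real.log y + 2)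
    (hcapx : ∀ m : ℕ, #(Px.filter (fun q => q ∣ m ∧ m ≠ 0)) ≤ (m.factorization.sum fun _ v => min v 2))
    (hcapx' : ∀ n : ℕ, n ≤ x → ∀ i : Fin k,
      (((f i).eval (n : ℤ)).toNat.factorization.sum fun _ v => min v 2) ≤
        #(Px.filter (fun q => q ∣ ((f i).eval (n : ℤ)).toNat ∧ ((f i).eval (n : ℤ)).toNat ≠ 0)) +
          2 * ((f i).natDegree + ∑ j ∈ range ((f i).natDegree + 1), ((f i).coeff j).natAbs))
    (hK : K = ∑ i, (2 * (((f i).natDegree : ℝ) +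
      ((∑ j ∈ range ((f i).natDegree + 1), ((f i).coeff j).natAbs : ℕ) : ℝ))))
    (hFa0 : (∑ n ∈ range (x + 1), ∑ t ∈ (univ : Finset (Fin k)) ×ˢ Pz, Zf t n) / ((x : ℝ) + 1) -
        (∑ n ∈ range (x + 1), (∑ t ∈ (univ : Finset (Fin k)) ×ˢ Pz, Zf t n) ^ 2) / ((x : ℝ) + 1) +
      ((∑ n ∈ range (x + 1), ∑ t ∈ (univ : Finset (Fin k)) ×ˢ Pz, Zf t n) / ((x : ℝ) + 1)) ^ 2 ≤
      (k : ℝ) ^ 2 * (2 * CpS + 32 * D ^ 2))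
    (hcovU0 : -((k : ℝ) ^ 2 * (2 * CpS + 4 * D ^ 2 * (8 + C2))) ≤
      (∑ n ∈ range (x + 1), (∑ t ∈ (univ : Finset (Fin k)) ×ˢ Pz, Zf t n) *
          ∑ t' ∈ (univ : Finset (Fin k)) ×ˢ (Px \ Pz), Zf t' n) / ((x : ℝ) + 1) -
        (∑ n ∈ range (x + 1), ∑ t ∈ (univ : Finset (Fin k)) ×ˢ Pz, Zf t n) / ((x : ℝ) + 1) *
          ((∑ n ∈ range (x + 1), ∑ t' ∈ (univ : Finset (Fin k)) ×ˢ (Px \ Pz), Zf t' n) /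
            ((x : ℝ) + 1)))
    (hCKx : -CK ≤
      (∑ n ∈ Finset.range (x + 1),
          (∑ i, ∑ q ∈ Py.filter
              (fun q => q ∣ ((f i).eval (n : ℤ)).toNat ∧ ((f i).eval (n : ℤ)).toNat ≠ 0),
            (1 - 2 * ArithmeticFunction.vonMangoldt q / Real.log y)) *
          (((∑ i, (((f i).eval (n : ℤ)).toNat.factorization.sum fun _ v => min v 2) : ℕ) : ℝ) -
            ((∑ i, #(Px.filter
              (fun q => q ∣ ((f i).eval (n : ℤ)).toNat ∧ ((f i).eval (n : ℤ)).toNat ≠ 0)) : ℕ) : ℝ))) /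
          ((x : ℝ) + 1) -
        (∑ n ∈ Finset.range (x + 1),
            (∑ i, ∑ q ∈ Py.filter
                (fun q => q ∣ ((f i).eval (n : ℤ)).toNat ∧ ((f i).eval (n : ℤ)).toNat ≠ 0),
              (1 - 2 * ArithmeticFunction.vonMangoldt q / Real.log y))) /
            ((x : ℝ) + 1) *
          ((∑ n ∈ Finset.range (x + 1),
              (((∑ i, (((f i).eval (n : ℤ)).toNat.factorization.sum fun _ v => min v 2) : ℕ) : ℝ) -
                ((∑ i, #(Px.filter
                  (fun q => q ∣ ((f i).eval (n : ℤ)).toNat ∧ ((f i).eval (n : ℤ)).toNat ≠ 0)) : ℕ) :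
                  ℝ))) /
            ((x : ℝ) + 1))),
    ((∑ n ∈ Finset.range (x + 1), ∑ i, (((f i).eval (n : ℤ)).toNat.factorization.sum
        fun _ v => min v 2) : ℕ) : ℝ) / ((x : ℝ) + 1) -
      (((∑ n ∈ Finset.range (x + 1), (∑ i, (((f i).eval (n : ℤ)).toNat.factorization.sum
          fun _ v => min v 2)) ^ 2 : ℕ) : ℝ) / ((x : ℝ) + 1) -
        (((∑ n ∈ Finset.range (x + 1), ∑ i, (((f i).eval (n : ℤ)).toNat.factorization.sum
            fun _ v => min v 2) : ℕ) : ℝ) / ((x : ℝ) + 1)) ^ 2) ≤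
    ((k : ℝ) ^ 2 * (2 * CpS + 32 * D ^ 2)) + (2 * k * D * (cW + 1) + K) +
      2 * ((k : ℝ) ^ 2 * (2 * CpS + 4 * D ^ 2 * (8 + C2))) +
      2 * (2 * k * D * (cW + 1) * K + 16 * k * D * K + |CK|) := by
  intro k f x y Px Pz Py Zf D K CpS cW C2 CK hx1 hD0 hK0 hlogy hPyz hPzx hZfdef he hsum1 hsum2 hsum3 hcapx hcapx' hK hFa0 hcovU0 hCKx
  classical
  have hY0 : (0 : ℝ) < (x : ℝ) + 1 := by positivity
  have hlogy0 : 0 < Real.log y := by linarith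
  have hZf01 : ∀ t n, Zf t n = 0 ∨ Zf t n = 1 := fun t n => by
    rw [hZfdef]; split_ifs <;> simp
  have hZf0 : ∀ t n, 0 ≤ Zf t n := fun t n => by rcases hZf01 t n with h | h <;> simp [h]
  have hZcard : ∀ (i : Fin k) (S : Finset ℕ) (n : ℕ), ∑ q ∈ S, Zf (i, q) n =
      (#(S.filter (fun q => q ∣ ((f i).eval (n : ℤ)).toNat ∧ ((f i).eval (n : ℤ)).toNat ≠ 0)) : ℝ) := by
    intro i S n
    simp only [hZfdef]
    rw [sum_boole]
  /- ### the split `s = a + b`, `b = U + N` -/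
  obtain ⟨a, ha⟩ : ∃ a : ℕ → ℝ, a = fun n => ∑ t ∈ (univ : Finset (Fin k)) ×ˢ Pz, Zf t n := ⟨_, rfl⟩
  obtain ⟨U, hU⟩ : ∃ U : ℕ → ℝ, U = fun n => ∑ t ∈ (univ : Finset (Fin k)) ×ˢ (Px \ Pz), Zf t n :=
    ⟨_, rfl⟩
  obtain ⟨sN, hsN⟩ : ∃ sN : ℕ → ℝ, sN = fun n : ℕ =>
      ((∑ i, (((f i).eval (n : ℤ)).toNat.factorization.sum fun _ v => min v 2) : ℕ) : ℝ) := ⟨_, rfl⟩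
  obtain ⟨AX, hAX⟩ : ∃ AX : ℕ → ℝ, AX = fun n : ℕ =>
      ((∑ i, #((Px).filter
        (fun q => q ∣ ((f i).eval (n : ℤ)).toNat ∧ ((f i).eval (n : ℤ)).toNat ≠ 0)) : ℕ) : ℝ) := ⟨_, rfl⟩
  obtain ⟨N, hN⟩ : ∃ N : ℕ → ℝ, N = fun n => sN n - AX n := ⟨_, rfl⟩
  obtain ⟨b, hb⟩ : ∃ b : ℕ → ℝ, b = fun n => sN n - a n := ⟨_, rfl⟩
  have haf : ∀ n, ∑ t ∈ (univ : Finset (Fin k)) ×ˢ Pz, Zf t n = a n := fun n => by rw [ha]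
  have hUf : ∀ n, ∑ t ∈ (univ : Finset (Fin k)) ×ˢ (Px \ Pz), Zf t n = U n := fun n => by rw [hU]
  have ha_i : ∀ n, a n = ∑ i, ∑ q ∈ Pz, Zf (i, q) n := fun n => by
    rw [ha]
    exact sum_product _ _ _
  have hU_i : ∀ n, U n = ∑ i, ∑ q ∈ Px \ Pz, Zf (i, q) n := fun n => by
    rw [hU]
    exact sum_product _ _ _
  have hAX_i : ∀ n, AX n = ∑ i, ∑ q ∈ Px, Zf (i, q) n := fun n => by
    rw [hAX]
    push_cast
    exact sum_congr rfl fun i _ => (hZcard i _ n).symm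
  have haU : ∀ n, a n + U n = AX n := fun n => by
    rw [ha_i, hU_i, hAX_i, ← sum_add_distrib]
    refine sum_congr rfl fun i _ => ?_
    rw [add_comm, sum_sdiff (hPzx)]
  have hbUN : ∀ n, b n = U n + N n := fun n => by
    rw [hb, hN]
    simp only
    linarith [haU n]
  have hab : ∀ n, a n + b n = sN n := fun n => by rw [hb]; simp only; ring
  -- pointwise bounds: `0 ≤ N ≤ K`, `0 ≤ U`
  have hN0 : ∀ n, 0 ≤ N n := fun n => by
    rw [hN, hsN, hAX]
    simp only [sub_nonneg]
    exact_mod_cast sum_le_sum fun i _ => hcapx _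
  have hNK : ∀ n ∈ range (x + 1), N n ≤ K := fun n hn => by
    have hnx : n ≤ x := Nat.lt_succ_iff.1 (mem_range.1 hn)
    rw [hN, hsN, hAX, hK]
    simp only
    have h1 : ((∑ i, (((f i).eval (n : ℤ)).toNat.factorization.sum fun _ v => min v 2) : ℕ) : ℝ) ≤
        ((∑ i, (#((Px).filter
          (fun q => q ∣ ((f i).eval (n : ℤ)).toNat ∧ ((f i).eval (n : ℤ)).toNat ≠ 0)) +
          2 * ((f i).natDegree + ∑ j ∈ range ((f i).natDegree + 1), ((f i).coeff j).natAbs)) : ℕ) : ℝ) := by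
      exact_mod_cast sum_le_sum fun i _ => hcapx' n hnx i
    push_cast at h1 ⊢
    rw [sum_add_distrib] at h1
    linarith
  have hEN0 : 0 ≤ (∑ n ∈ range (x + 1), N n) / ((x : ℝ) + 1) :=
    div_nonneg (sum_nonneg fun n _ => hN0 n) hY0.le
  have hEN : (∑ n ∈ range (x + 1), N n) / ((x : ℝ) + 1) ≤ K := by
    rw [div_le_iff₀ hY0]
    calc ∑ n ∈ range (x + 1), N n ≤ ∑ n ∈ range (x + 1), K := sum_le_sum hNK
      _ = K * ((x : ℝ) + 1) := by rw [sum_const, card_range, nsmul_eq_mul]; push_cast; ring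
  /- ### the deficit of `s` in terms of `a` and `b` -/
  have hc1 : ((∑ n ∈ Finset.range (x + 1), ∑ i, (((f i).eval (n : ℤ)).toNat.factorization.sum
      fun _ v => min v 2) : ℕ) : ℝ) = ∑ n ∈ range (x + 1), sN n := by
    rw [Nat.cast_sum, hsN]
  have hc2 : (((∑ n ∈ Finset.range (x + 1), (∑ i, (((f i).eval (n : ℤ)).toNat.factorization.sum
      fun _ v => min v 2)) ^ 2 : ℕ) : ℝ)) = ∑ n ∈ range (x + 1), sN n ^ 2 := by
    rw [Nat.cast_sum, hsN]
    simp only [Nat.cast_pow]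
  rw [hc1, hc2]
  have hdef := deficit_add_eq x ((x : ℝ) + 1) a b
  simp only [hab] at hdef
  -- `E b − Var b ≤ E b ≤ 2kD(cW + 1) + K`
  have hvarb := sq_mean_le_mean_sq x b
  have hEb : (∑ n ∈ range (x + 1), b n) / ((x : ℝ) + 1) ≤ 2 * k * D * (cW + 1) + K := by
    have hEU : (∑ n ∈ range (x + 1), U n) / ((x : ℝ) + 1) ≤ 2 * k * D * (cW + 1) := by
      calc (∑ n ∈ range (x + 1), U n) / ((x : ℝ) + 1)
          = ∑ t ∈ (univ : Finset (Fin k)) ×ˢ (Px \ Pz),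
              (∑ n ∈ range (x + 1), Zf t n) / ((x : ℝ) + 1) := by
            simp_rw [← hUf]; rw [sum_comm, sum_div]
        _ ≤ ∑ t ∈ (univ : Finset (Fin k)) ×ˢ (Px \ Pz), 2 * D / (t.2 : ℝ) :=
            sum_le_sum fun t ht => he t (mem_sdiff.1 (mem_product.1 ht).2).1
        _ = (k : ℝ) * ∑ q ∈ Px \ Pz, 2 * D / (q : ℝ) := by
            rw [sum_product]
            simp only [sum_const, card_univ, Fintype.card_fin, nsmul_eq_mul]
        _ = (k : ℝ) * (2 * D * ∑ q ∈ Px \ Pz, (1 : ℝ) / (q : ℝ)) := by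
            rw [mul_sum _ _ (2 * D)]
            refine congrArg _ (sum_congr rfl fun q _ => ?_)
            ring
        _ ≤ (k : ℝ) * (2 * D * (cW + 1)) := by gcongr
        _ = 2 * k * D * (cW + 1) := by ring
    calc (∑ n ∈ range (x + 1), b n) / ((x : ℝ) + 1)
        = (∑ n ∈ range (x + 1), U n) / ((x : ℝ) + 1) + (∑ n ∈ range (x + 1), N n) / ((x : ℝ) + 1) := by
          simp_rw [hbUN]; rw [sum_add_distrib, add_div]
      _ ≤ _ := add_le_add hEU hEN
  /- ### block `E a − Var a` -/
  have hFa := hFa0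
  simp only [haf] at hFa
  /- ### `Cov(a, b) = Cov(a, U) + Cov(a, N)` -/
  have hcov_split : (∑ n ∈ range (x + 1), a n * b n) / ((x : ℝ) + 1) -
        (∑ n ∈ range (x + 1), a n) / ((x : ℝ) + 1) * ((∑ n ∈ range (x + 1), b n) / ((x : ℝ) + 1)) =
      ((∑ n ∈ range (x + 1), a n * U n) / ((x : ℝ) + 1) -
        (∑ n ∈ range (x + 1), a n) / ((x : ℝ) + 1) * ((∑ n ∈ range (x + 1), U n) / ((x : ℝ) + 1))) +
      ((∑ n ∈ range (x + 1), a n * N n) / ((x : ℝ) + 1) -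
        (∑ n ∈ range (x + 1), a n) / ((x : ℝ) + 1) * ((∑ n ∈ range (x + 1), N n) / ((x : ℝ) + 1))) := by
    have e1 : ∑ n ∈ range (x + 1), a n * b n =
        ∑ n ∈ range (x + 1), a n * U n + ∑ n ∈ range (x + 1), a n * N n := by
      rw [← sum_add_distrib]
      exact sum_congr rfl fun n _ => by rw [hbUN]; ring
    have e2 : ∑ n ∈ range (x + 1), b n = ∑ n ∈ range (x + 1), U n + ∑ n ∈ range (x + 1), N n := by
      rw [← sum_add_distrib]
      exact sum_congr rfl fun n _ => hbUN n
    rw [e1, e2]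
    ring
  /- ### block `Cov(a, U)` -/
  have hcovU := hcovU0
  simp only [haf, hUf] at hcovU
  /- ### block `Cov(a, N)`: the log-mass projection -/
  obtain ⟨W, hW⟩ : ∃ W : ℕ → ℝ, W = fun n : ℕ => ∑ i, ∑ q ∈ (Py).filter
      (fun q => q ∣ ((f i).eval (n : ℤ)).toNat ∧ ((f i).eval (n : ℤ)).toNat ≠ 0),
      (1 - 2 * ArithmeticFunction.vonMangoldt q / Real.log y) := ⟨_, rfl⟩
  obtain ⟨Mm, hMm⟩ : ∃ Mm : ℕ → ℝ, Mm = fun n : ℕ => ∑ i, ∑ q ∈ (Py).filter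
      (fun q => q ∣ ((f i).eval (n : ℤ)).toNat ∧ ((f i).eval (n : ℤ)).toNat ≠ 0),
      ArithmeticFunction.vonMangoldt q := ⟨_, rfl⟩
  have hlam0 : (0 : ℝ) ≤ 2 / Real.log y := by positivity
  -- `A_y = W + λ M`
  have hW1 : ∀ n, ∑ i, ∑ q ∈ Py, Zf (i, q) n = W n + 2 / Real.log y * Mm n := by
    intro n
    rw [hW, hMm]
    simp only
    rw [mul_sum, ← sum_add_distrib]
    refine sum_congr rfl fun i _ => ?_
    rw [hZcard i _ n, card_eq_sum_ones]
    push_cast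
    rw [mul_sum, ← sum_add_distrib]
    exact sum_congr rfl fun q _ => by ring
  -- `M ≥ 0`, `E M ≤ 2kD(2 log y + 2)`
  have hMm_i : ∀ n, Mm n = ∑ i, ∑ q ∈ Py, ArithmeticFunction.vonMangoldt q * Zf (i, q) n := by
    intro n
    rw [hMm]
    simp only
    refine sum_congr rfl fun i _ => ?_
    rw [sum_filter]
    refine sum_congr rfl fun q _ => ?_
    simp only [hZfdef, mul_ite, mul_one, mul_zero]
  have hMm0 : ∀ n, 0 ≤ Mm n := fun n => by
    rw [hMm_i]
    exact sum_nonneg fun i _ => sum_nonneg fun q _ =>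
      mul_nonneg ArithmeticFunction.vonMangoldt_nonneg (hZf0 _ n)
  have hEM : (∑ n ∈ range (x + 1), Mm n) / ((x : ℝ) + 1) ≤ 2 * k * D * (2 * Real.log y + 2) := by
    calc (∑ n ∈ range (x + 1), Mm n) / ((x : ℝ) + 1)
        = ∑ t ∈ (univ : Finset (Fin k)) ×ˢ Py, ArithmeticFunction.vonMangoldt t.2 *
            ((∑ n ∈ range (x + 1), Zf t n) / ((x : ℝ) + 1)) := by
          simp_rw [hMm_i]
          rw [sum_comm, sum_div, sum_product]
          refine sum_congr rfl fun i _ => ?_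
          rw [sum_comm, sum_div]
          refine sum_congr rfl fun q _ => ?_
          rw [← mul_sum, mul_div_assoc]
      _ ≤ ∑ t ∈ (univ : Finset (Fin k)) ×ˢ Py, ArithmeticFunction.vonMangoldt t.2 *
            (2 * D / (t.2 : ℝ)) :=
          sum_le_sum fun t ht => mul_le_mul_of_nonneg_left
            (he t ((hPyz.trans hPzx) (mem_product.1 ht).2)) ArithmeticFunction.vonMangoldt_nonneg
      _ = (k : ℝ) * ∑ q ∈ Py, ArithmeticFunction.vonMangoldt q * (2 * D / (q : ℝ)) := by
          rw [sum_product]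
          simp only [sum_const, card_univ, Fintype.card_fin, nsmul_eq_mul]
      _ = (k : ℝ) * (2 * D * ∑ q ∈ Py, ArithmeticFunction.vonMangoldt q / (q : ℝ)) := by
          rw [mul_sum _ _ (2 * D)]
          refine congrArg _ (sum_congr rfl fun q _ => ?_)
          ring
      _ ≤ (k : ℝ) * (2 * D * (2 * Real.log y + 2)) := by gcongr
      _ = 2 * k * D * (2 * Real.log y + 2) := by ring
  have hlamM : 2 / Real.log y * ((∑ n ∈ range (x + 1), Mm n) / ((x : ℝ) + 1)) * K ≤ 16 * k * D * K := by
    set L : ℝ := Real.log y with hL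
    set EMv : ℝ := (∑ n ∈ range (x + 1), Mm n) / ((x : ℝ) + 1) with hEMv
    clear_value L EMv
    have h1 : 2 / L * EMv * K ≤ 2 / L * (2 * k * D * (2 * L + 2)) * K :=
      mul_le_mul_of_nonneg_right (mul_le_mul_of_nonneg_left hEM hlam0) hK0
    have h2 : 2 / L * (2 * k * D * (2 * L + 2)) * K = 8 * k * D * K + 8 * k * D * K / L := by
      field_simp
      ring
    have h3 : 8 * k * D * K / L ≤ 8 * k * D * K := div_le_self (by positivity) hlogy
    linarith
  -- `E(A_z − A_y) ≤ 2kD(cW + 1)`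
  have hEaY : (∑ n ∈ range (x + 1), ∑ i, ∑ q ∈ Pz \ Py, Zf (i, q) n) / ((x : ℝ) + 1) ≤
      2 * k * D * (cW + 1) := by
    calc (∑ n ∈ range (x + 1), ∑ i, ∑ q ∈ Pz \ Py, Zf (i, q) n) / ((x : ℝ) + 1)
        = ∑ t ∈ (univ : Finset (Fin k)) ×ˢ (Pz \ Py),
            (∑ n ∈ range (x + 1), Zf t n) / ((x : ℝ) + 1) := by
          rw [sum_comm, sum_div, sum_product]
          refine sum_congr rfl fun i _ => ?_
          rw [sum_comm, sum_div]
      _ ≤ ∑ t ∈ (univ : Finset (Fin k)) ×ˢ (Pz \ Py), 2 * D / (t.2 : ℝ) :=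
          sum_le_sum fun t ht => he t (hPzx ((mem_sdiff.1 (mem_product.1 ht).2).1))
      _ = (k : ℝ) * ∑ q ∈ Pz \ Py, 2 * D / (q : ℝ) := by
          rw [sum_product]
          simp only [sum_const, card_univ, Fintype.card_fin, nsmul_eq_mul]
      _ = (k : ℝ) * (2 * D * ∑ q ∈ Pz \ Py, (1 : ℝ) / (q : ℝ)) := by
          rw [mul_sum _ _ (2 * D)]
          refine congrArg _ (sum_congr rfl fun q _ => ?_)
          ring
      _ ≤ (k : ℝ) * (2 * D * (cW + 1)) := by gcongr
      _ = 2 * k * D * (cW + 1) := by ring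
  -- the decorrelated covariance bound, verbatim
  have hK1x : -CK ≤ (∑ n ∈ range (x + 1), W n * N n) / ((x : ℝ) + 1) -
      (∑ n ∈ range (x + 1), W n) / ((x : ℝ) + 1) * ((∑ n ∈ range (x + 1), N n) / ((x : ℝ) + 1)) := by
    rw [hW, hN, hsN, hAX]
    exact hCKx
  have hcovN := covN_ge Zf x Pz Py K (2 * k * D * (cW + 1)) (16 * k * D * K) CK (2 / Real.log y)
    N W Mm hPyz hZf0 hlam0 hN0 hEN hMm0 hW1 hEaY hlamM hK1x
  simp only [haf] at hcovN
  /- ### conclusion -/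
  have hgoal : (∑ n ∈ range (x + 1), sN n) / ((x : ℝ) + 1) -
      ((∑ n ∈ range (x + 1), sN n ^ 2) / ((x : ℝ) + 1) -
        ((∑ n ∈ range (x + 1), sN n) / ((x : ℝ) + 1)) ^ 2) =
      (∑ n ∈ range (x + 1), sN n) / ((x : ℝ) + 1) -
        (∑ n ∈ range (x + 1), sN n ^ 2) / ((x : ℝ) + 1) +
        ((∑ n ∈ range (x + 1), sN n) / ((x : ℝ) + 1)) ^ 2 := by ring
  have hCKabs : CK ≤ |CK| := le_abs_self CK
  rw [hgoal, hdef, hcov_split]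
  linarith [hvarb, hEb, hFa, hcovU, hcovN]

end Summit.Parity.BatemanHorn.Cruxes.SystemMomentDeficit.Ideator3Sketch
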